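import Summits.ResolutionOfSingularities.ResolutionOfSingularities.Theorems.FrobeniusLadderFInjectiveMacaulayficationDesingularizationOffClosedPointsFibre
import Summits.ResolutionOfSingularities.ResolutionOfSingularities.Theorems.FrobeniusLadderFInjectiveMacaulayficationLocalBlowupDesingularizationDimThree
import Summits.ResolutionOfSingularities.ResolutionOfSingularities.Theorems.FrobeniusLadderFInjectiveMacaulayficationTerminationModClosedPoints
import HarnessLib

/-!
# (LR♭) `LocalResolutionNonClosedGe4Fibre` — the «LD» door's local-resolution stub in TEMKIN'S (iii) FORM (fibre-singular local blow-ups only) — and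
# REGULAR OFF FINITELY MANY CLOSED POINTS in every dimension ≥ 3 modulo (LR♭) + the threefold package (crux `FInjectiveMacaulayfication`
# stmt-ResolutionOfSingularities-15315, chain w45a; res-L1-w45a-plan-1 RULING R17.4 «LD» (E2) + res-L1-w45a-tri-2 23:53:32Z; seat res-L1-w45a-stub-3 g7)

[OURS · L1 W4.5a] Support file (`--supports stmt-ResolutionOfSingularities-15315 --as helper`); replaces the role of NO printed item; NOT a statement of
any manuscript; ONE definition (`@[conjecture] def`, an OURS candidate statement consumed only as a hypothesis; no instance, no notation, no named fact)
and its consumers, which are moreover CONDITIONAL on {CP 2019 Thm. 1.1 (i)(ii), Raynaud–Gruson 5.2.2, CP 2019 Prop. 4.4} BY NAME. AI-written (AI review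
is weaker than expert review). Twin of `…RegularOffFiniteOfLR` (the unrestricted (LR)); (LR) ⇒ (LR♭) (`…_of_localResolutionNonClosedGe4`, (LR)'s text
taken as a binder), so (LR♭) is the weaker-or-equal registered residue — the (L4) → (L4♭) pattern.

* `LocalResolutionNonClosedGe4Fibre` — (LR♭) = [Temkin 2008, Prop. 2.3.4 (iii)] sliced to NON-closed points of local dimension ≥ 4: every blowing up
  `g : S′ → Spec 𝒪_{X,x}` WHOSE SINGULAR POINTS LIE IN THE CLOSED FIBRE admits a desingularization. ≤ S_loc; vacuous on fourfolds. [candidate, OURS; open]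
* `hlocFibre_of_cp_of_LRfibre` — the disjunctive hypothesis of `DesingularizationOffClosedPointsFibre.desingularization_offClosedPoints_of_local_fibre`
  from CP (second disjunct below local dimension 4, at a loc-dim-3 specialisation) and (LR♭) (first disjunct at local dimension ≥ 4).
* **`regularOffFinite_of_LRfibre (hG h081R hP) (hLR♭) … (h3 : 3 ≤ topologicalKrullDim X)`** — regular off finitely many closed points, every dimension ≥ 3.
[cite: Temkin2008, Prop. 2.3.4 (iii); Def. 2.2.6] [cite: CossartPiltant2019, Thm. 1.1 (i)(ii); Prop. 4.4] [cite: GortzWedhorn2020, Thm. 5.22]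
-/

-- single-problem summit: the doubled namespace component is forced
set_option linter.dupNamespace false

noncomputable section

namespace Summit.ResolutionOfSingularities.ResolutionOfSingularities.Theorems.FInjectiveMacaulayfication.RegularOffFiniteOfLRFibre

open CategoryTheory CategoryTheory.Limits AlgebraicGeometry TopologicalSpace IsLocalRing
open Literature.AlgebraicGeometry.Resolution
open Summit.ResolutionOfSingularities.ResolutionOfSingularities.Theorems.FInjectiveMacaulayfication

/-! ## §1 The candidate (LR♭) and its comparison with (LR) -/

/-- [OURS · candidate statement, the «LD» door's LOCAL RESOLUTION stub, Temkin (iii) form] **(LR♭) `LocalResolutionNonClosedGe4Fibre`**: for every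
prime `p`, field `k` of characteristic `p`, INTEGRAL separated finite-type `k`-scheme `X` and NON-CLOSED point `x ∈ X` with `4 ≤ dim 𝒪_{X,x}`, every
blowing up `g : S′ → Spec 𝒪_{X,x}` along an ideal sheaf `I` WHOSE SINGULAR POINTS ALL LIE IN THE CLOSED FIBRE admits a desingularization
(`Scheme.AdmitsDesingularization S′`, Temkin 2008 Def. 2.2.6). [candidate statement, OURS; open] [cite: Temkin2008, Prop. 2.3.4 (iii); Def. 2.2.6] -/
@[conjecture] def LocalResolutionNonClosedGe4Fibre : Prop :=
  ∀ (p : ℕ), p.Prime → ∀ (k : Type) [Field k] [CharP k p]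
    (X : Scheme.{0}) (f : X ⟶ Spec (.of k)),
      IsSeparated f → LocallyOfFiniteType f → QuasiCompact f → IsIntegral X →
      ∀ x : X, ¬ IsClosed ({x} : Set X) → (4 : WithBot ℕ∞) ≤ ringKrullDim (X.presheaf.stalk x) →
      ∀ (S' : Scheme.{0}) (g : S' ⟶ Spec (X.presheaf.stalk x)) (I : (Spec (X.presheaf.stalk x)).IdealSheafData),
        IsBlowup g I → (∀ s : S', s ∉ Scheme.regularLocus S' → g.base s = closedPoint (X.presheaf.stalk x)) →
        Scheme.AdmitsDesingularization S'

/-- **(LR) ⇒ (LR♭)** ((LR) = `RegularOffFiniteOfLR.LocalResolutionNonClosedGe4`, its ∀-text taken here as a binder): forget the fibre clause.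
[plumbing] -/
theorem localResolutionNonClosedGe4Fibre_of_localResolutionNonClosedGe4
    (h : ∀ (p : ℕ), p.Prime → ∀ (k : Type) [Field k] [CharP k p]
      (X : Scheme.{0}) (f : X ⟶ Spec (.of k)),
        IsSeparated f → LocallyOfFiniteType f → QuasiCompact f → IsIntegral X →
        ∀ x : X, ¬ IsClosed ({x} : Set X) → (4 : WithBot ℕ∞) ≤ ringKrullDim (X.presheaf.stalk x) →
        ∀ (S' : Scheme.{0}) (g : S' ⟶ Spec (X.presheaf.stalk x)) (I : (Spec (X.presheaf.stalk x)).IdealSheafData),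
          IsBlowup g I → Scheme.AdmitsDesingularization S') :
    LocalResolutionNonClosedGe4Fibre :=
  fun p hp k _ _ X f hs hl hq hi x hx h4 S' g I hg _ => h p hp k X f hs hl hq hi x hx h4 S' g I hg

/-! ## §2 The hypothesis of THEOREM A♭ from CP + (LR♭) -/

/-- **(hloc) of `desingularization_offClosedPoints_of_local_fibre` from Cossart–Piltant below local dimension 4 and (LR♭) at local dimension ≥ 4**
(`X` integral of finite type over `k`, `dim X ≥ 3`). [OURS · conditional-result] [cite: CossartPiltant2019, Thm. 1.1 (i)(ii); Prop. 4.4]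
[cite: GortzWedhorn2020, Thm. 5.22] -/
theorem hlocFibre_of_cp_of_LRfibre
    (hG : CossartPiltant2019General.{0}) (h081R : Stacks081R.{0}) (hP : CossartPiltant2019Principalization.{0})
    (hLR : LocalResolutionNonClosedGe4Fibre)
    (p : ℕ) (hp : p.Prime) (k : Type) [Field k] [CharP k p] (X : Scheme.{0}) (f₀ : X ⟶ Spec (.of k))
    [IsSeparated f₀] [LocallyOfFiniteType f₀] [QuasiCompact f₀] [IsIntegral X] (h3 : (3 : WithBot ℕ∞) ≤ topologicalKrullDim X) :
    ∀ ζ : X, ¬ IsClosed ({ζ} : Set X) →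
      (∀ (S' : Scheme.{0}) (g : S' ⟶ Spec (X.presheaf.stalk ζ)) (I : (Spec (X.presheaf.stalk ζ)).IdealSheafData),
        IsBlowup g I → (∀ s : S', s ∉ Scheme.regularLocus S' → g.base s = closedPoint (X.presheaf.stalk ζ)) →
          Scheme.AdmitsDesingularization S') ∨
      (∃ x : X, ζ ⤳ x ∧ ∀ (S' : Scheme.{0}) (g : S' ⟶ Spec (X.presheaf.stalk x)) (I : (Spec (X.presheaf.stalk x)).IdealSheafData),
        IsBlowup g I → Scheme.AdmitsDesingularization S') := by
  intro ζ hζ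
  haveI : IsLocallyNoetherian X := LocallyOfFiniteType.isLocallyNoetherian f₀
  haveI : CompactSpace X := QuasiCompact.compactSpace_of_compactSpace f₀
  obtain ⟨d₀, hd₀⟩ := exists_topologicalKrullDim_le_of_locallyOfFiniteType f₀
  obtain ⟨d, hd⟩ := exists_topologicalKrullDim_eq_nat hd₀
  have h3d : 3 ≤ d := by
    rw [hd] at h3
    exact_mod_cast h3
  obtain ⟨n, hn⟩ := exists_nat_cast_eq_ringKrullDim (R := X.presheaf.stalk ζ)
  by_cases hn3 : n ≤ 3
  · -- below local dimension 4: specialise to a loc-dim-3 point, Cossart–Piltant there (no fibre condition needed)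
    obtain ⟨x, hζx, hx3⟩ := RegularOffCodimFourResidue.exists_specializes_ringKrullDim_stalk_eq f₀ hd ζ (n := 3)
      (by rw [hn]; exact_mod_cast hn3) h3d
    exact Or.inr ⟨x, hζx, LocalBlowupDesingularizationDimThree.localBlowups_hloc hG h081R hP f₀ x hx3⟩
  · -- local dimension ≥ 4: (LR♭) at `ζ` itself
    refine Or.inl (hLR p hp k X f₀ inferInstance inferInstance inferInstance inferInstance ζ hζ ?_)
    rw [hn]
    exact_mod_cast (by omega : 4 ≤ n)

/-! ## §3 Regular off finitely many closed points, every dimension ≥ 3, modulo (LR♭) -/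

/-- **REGULAR OFF FINITELY MANY CLOSED POINTS in every dimension ≥ 3, modulo (LR♭) and the threefold package**: for `X` integral separated of
finite type over `k` with `dim X ≥ 3` there are a blowing up `f : X′ → X` along `J` with `Supp J ⊆ (Reg X)ᶜ` and a closed FINITE set `F` of CLOSED
points with `X′` regular at every point not over `F`. [OURS · conditional-result] [cite: Temkin2008, Prop. 2.3.4] [cite: CossartPiltant2019, Thm. 1.1 (i)(ii); Prop. 4.4] -/
theorem regularOffFinite_of_LRfibre
    (hG : CossartPiltant2019General.{0}) (h081R : Stacks081R.{0}) (hP : CossartPiltant2019Principalization.{0})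
    (hLR : LocalResolutionNonClosedGe4Fibre)
    (p : ℕ) (hp : p.Prime) (k : Type) [Field k] [CharP k p] (X : Scheme.{0}) (f₀ : X ⟶ Spec (.of k))
    [IsSeparated f₀] [LocallyOfFiniteType f₀] [QuasiCompact f₀] [IsIntegral X] (h3 : (3 : WithBot ℕ∞) ≤ topologicalKrullDim X) :
    ∃ (X' : Scheme.{0}) (f : X' ⟶ X) (J : X.IdealSheafData) (F : Set X), IsBlowup f J ∧
      (J.support : Set X) ⊆ (Scheme.regularLocus X)ᶜ ∧ IsClosed F ∧ F.Finite ∧ (∀ b ∈ F, IsClosed ({b} : Set X)) ∧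
      ∀ x' : X', f x' ∉ F → x' ∈ Scheme.regularLocus X' := by
  have hk : Scheme.IsQuasiExcellent (Spec (.of k)) :=
    Scheme.isQuasiExcellent_of_locallyOfFiniteType Stacks07QW_field_holds (𝟙 (Spec (.of k)))
  haveI : IsNoetherianRing (CommRingCat.of k) := inferInstanceAs (IsNoetherianRing k)
  exact DesingularizationOffClosedPointsFibre.desingularization_offFinite_of_local_fibre hk f₀
    (hlocFibre_of_cp_of_LRfibre hG h081R hP hLR p hp k X f₀ h3)

/-- The same with `J ≠ ⊥` recorded (the generic point is regular, hence off `Supp J`). [OURS · conditional-result] [cite: Temkin2008, Prop. 2.3.4] -/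
theorem regularOffFinite_of_LRfibre'
    (hG : CossartPiltant2019General.{0}) (h081R : Stacks081R.{0}) (hP : CossartPiltant2019Principalization.{0})
    (hLR : LocalResolutionNonClosedGe4Fibre)
    (p : ℕ) (hp : p.Prime) (k : Type) [Field k] [CharP k p] (X : Scheme.{0}) (f₀ : X ⟶ Spec (.of k))
    [IsSeparated f₀] [LocallyOfFiniteType f₀] [QuasiCompact f₀] [IsIntegral X] (h3 : (3 : WithBot ℕ∞) ≤ topologicalKrullDim X) :
    ∃ (X' : Scheme.{0}) (f : X' ⟶ X) (J : X.IdealSheafData) (F : Set X), IsBlowup f J ∧ J ≠ ⊥ ∧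
      (J.support : Set X) ⊆ (Scheme.regularLocus X)ᶜ ∧ IsClosed F ∧ F.Finite ∧ (∀ b ∈ F, IsClosed ({b} : Set X)) ∧
      ∀ x' : X', f x' ∉ F → x' ∈ Scheme.regularLocus X' := by
  obtain ⟨X', f, J, F, hf, hJ, hFc, hF, hFcl, hreg⟩ := regularOffFinite_of_LRfibre hG h081R hP hLR p hp k X f₀ h3
  refine ⟨X', f, J, F, hf, fun h0 => ?_, hJ, hFc, hF, hFcl, hreg⟩
  have hgen : genericPoint X ∈ (J.support : Set X) := by rw [h0, Scheme.IdealSheafData.support_bot]; trivial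
  have := hJ hgen
  rw [Set.mem_compl_iff, Scheme.mem_regularLocus] at this
  exact this (inferInstanceAs (IsRegularLocalRing X.functionField))

end Summit.ResolutionOfSingularities.ResolutionOfSingularities.Theorems.FInjectiveMacaulayfication.RegularOffFiniteOfLRFibre

end
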